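import Literature.NumberTheory.LFunctions.ConreyVHorizontalEdges
import HarnessLib

/-!
# Polynomial growth of Conrey's `V` on the discs `|z − (b + iT)| ≤ b`

Topic `Literature/NumberTheory/LFunctions`. Everything here is PROVED; there are no definitions
and no named facts.

`ConreyVHorizontalEdges.lean` bounds `V = conreyV 𝜙 L` on the Backlund disc of radius `5/2` about
`5/2 + iT`. The Littlewood rectangle `[a, b] × [T₁, T₂]` of the mollified function `ψV`
(Conrey, J. Number Theory 16 (1983), §4 (4)) has its right edge at a half-integer `b = m + ½`
chosen according to the mollifier, and Backlund's lemma for `ψV` on its horizontal edges needs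
`sup |V|` on the discs `|z − (b + iT)| ≤ b`. Here: for `b ≥ 1`, `L ≥ 1`,
`T ≥ 2π(8b+8)² + 128π + b + 2` and `|z − (b+iT)| ≤ b`,

  `‖V(z)‖ ≤ (A₀ · 6·4^{2b+1} + 30 (2π)^{2b} A₂ · 6·4^{2b}) · T^{b+2}`

(`norm_conreyV_le_of_mem_closedBall_radius`; `A₀ = Σ |𝜙ₖ| k!`, `A₂ = Σ |𝜙̃ₖ| k!`), from the crude
Riemann–Siegel bounds `Literature.NumberTheory.LFunctions.SiegelIntegral.norm_riemannAux_le_rpow`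
on the circles `|w − z| = 1` (`|Re w| ≤ 2b+1`) and `‖χ(x+iy)‖ ≤ 15(2π)^x(y+½)`.

## References

* J. B. Conrey, *Zeros of derivatives of Riemann's ξ-function on the critical line*, J. Number
  Theory 16 (1983), 49–74, §4 (3)–(4). [Conrey1983]
* E. C. Titchmarsh, *The Theory of the Riemann Zeta-Function*, 2nd ed. (1986), §9.4, §10.28.
  [Titchmarsh1986]
-/

noncomputable section

open Complex Polynomial Set Filter Topology Metric MeasureTheory
open scoped Real ComplexConjugate

namespace Literature.NumberTheory.LFunctions

open Literature.Analysis.Complex SiegelIntegral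

/-- `√(y/2π) ≤ √T` when `y ≤ T + b + 1` and `T ≥ b + 1 ≥ 0`. [folklore] -/
theorem sqrt_div_two_pi_le_sqrt_of_le {y T b : ℝ} (hb : 0 ≤ b) (hT : b + 1 ≤ T) (hy : y ≤ T + b + 1) :
    Real.sqrt (y / (2 * π)) ≤ Real.sqrt T := by
  have hπ := Real.pi_gt_three
  refine Real.sqrt_le_sqrt ?_
  rw [div_le_iff₀ (by positivity)]
  nlinarith

/-- **Polynomial growth of `V` on the disc `|z − (b + iT)| ≤ b`** (`b ≥ 1`, `L ≥ 1`,
`T ≥ 2π(8b+8)² + 128π + b + 2`):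
`‖V(z)‖ ≤ (A₀ · 6·4^{2b+1} + 30 (2π)^{2b} A₂ · 6·4^{2b}) · T^{b+2}`. On the disc `0 ≤ Re z ≤ 2b`,
so on the circles `|w − z| = 1`: `|Re w| ≤ 2b+1`, `‖𝓡(w)‖ ≤ 6·4^{2b+1} T^{b+1}`,
`‖K(w)‖ ≤ 6·4^{2b} T^{b+1/2}`; and `‖χ(z)‖ ≤ 30 (2π)^{2b} T`. [cite: Conrey1983, §4 (3)–(4)] -/
theorem norm_conreyV_le_of_mem_closedBall_radius (φ : ℝ[X]) {b L T : ℝ} (hb : 1 ≤ b) (hL : 1 ≤ L)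
    (hT : 2 * π * (8 * b + 8) ^ 2 + 128 * π + b + 2 ≤ T) {z : ℂ}
    (hz : z ∈ closedBall ((b : ℂ) + T * I) b) :
    ‖conreyV φ L z‖ ≤
      ((∑ k ∈ φ.support, |φ.coeff k| * (k.factorial : ℝ)) * (6 * (4 : ℝ) ^ (2 * b + 1)) +
        30 * (2 * π) ^ (2 * b) * (∑ k ∈ (φ.comp (1 - X)).support,
          |(φ.comp (1 - X)).coeff k| * (k.factorial : ℝ)) * (6 * (4 : ℝ) ^ (2 * b))) *
        T ^ (b + 2) := by
  have hπ := Real.pi_pos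
  have hπ3 := Real.pi_gt_three
  have hsq : 0 ≤ 2 * π * (8 * b + 8) ^ 2 := by positivity
  have hT1 : b + 2 ≤ T := by nlinarith
  have hT1' : 1 ≤ T := by linarith
  have hT0 : 0 < T := by linarith
  set ψ : ℝ[X] := φ.comp (1 - X) with hψ
  set A₀ : ℝ := ∑ k ∈ φ.support, |φ.coeff k| * (k.factorial : ℝ) with hA₀
  set A₂ : ℝ := ∑ k ∈ ψ.support, |ψ.coeff k| * (k.factorial : ℝ) with hA₂
  have hA₀0 : 0 ≤ A₀ := Finset.sum_nonneg fun k _ ↦ by positivity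
  have hA₂0 : 0 ≤ A₂ := Finset.sum_nonneg fun k _ ↦ by positivity
  -- coordinates of `z`
  rw [mem_closedBall_iff_norm] at hz
  have hre := Complex.abs_re_le_norm (z - ((b : ℂ) + T * I))
  have him := Complex.abs_im_le_norm (z - ((b : ℂ) + T * I))
  simp only [sub_re, add_re, ofReal_re, mul_re, I_re, mul_zero, ofReal_im, I_im, mul_one,
    sub_self, add_zero, sub_im, add_im, mul_im, zero_add] at hre him
  obtain ⟨hz1, hz2⟩ := abs_le.1 (hre.trans hz)
  obtain ⟨hz3, hz4⟩ := abs_le.1 (him.trans hz)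
  -- points of the circles `|w - z| = 1`
  have hcirc : ∀ w ∈ sphere z 1,
      -1 ≤ w.re ∧ w.re ≤ 2 * b + 1 ∧ T - b - 1 ≤ w.im ∧ w.im ≤ T + b + 1 := by
    intro w hw
    rw [mem_sphere_iff_norm] at hw
    have h1 := Complex.abs_re_le_norm (w - z)
    have h2 := Complex.abs_im_le_norm (w - z)
    rw [hw, sub_re] at h1
    rw [hw, sub_im] at h2
    obtain ⟨h11, h12⟩ := abs_le.1 h1
    obtain ⟨h21, h22⟩ := abs_le.1 h2
    exact ⟨by linarith, by linarith, by linarith, by linarith⟩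
  have hxA : ∀ y : ℝ, T - b - 1 ≤ y → 8 * b + 8 ≤ Real.sqrt (y / (2 * π)) := by
    intro y hy
    have hy0 : 0 ≤ y := by linarith
    rw [Real.le_sqrt (by positivity) (by positivity), le_div_iff₀ (by positivity)]
    linarith
  have hsqrtT : ∀ p : ℝ, 0 ≤ p → ∀ y : ℝ, y ≤ T + b + 1 →
      Real.sqrt (y / (2 * π)) ^ p ≤ T ^ (p / 2) := by
    intro p hp y hy
    rw [← sqrt_rpow_eq hT0.le p]
    exact Real.rpow_le_rpow (Real.sqrt_nonneg _) (sqrt_div_two_pi_le_sqrt_of_le (by linarith) (by linarith) hy) hp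
  -- `𝓡` on the circle
  have hR : ∀ w ∈ sphere z 1, ‖riemannAux w‖ ≤ 6 * (4 : ℝ) ^ (2 * b + 1) * T ^ (b + 1) := by
    intro w hw
    obtain ⟨h1, h2, h3, h4⟩ := hcirc w hw
    have h := norm_riemannAux_le_rpow (σ := w.re) (A := 2 * b + 1) (t := w.im)
      (abs_le.2 ⟨by linarith, h2⟩) (by nlinarith) (by linarith [hxA w.im h3])
    rw [Complex.re_add_im] at h
    refine h.trans (mul_le_mul_of_nonneg_left ?_ (by positivity))
    have := hsqrtT (1 + (2 * b + 1)) (by positivity) w.im h4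
    refine this.trans (le_of_eq ?_)
    congr 1; ring
  -- `K` on the circle
  have hK : ∀ w ∈ sphere z 1, ‖riemannAuxConj w‖ ≤ 6 * (4 : ℝ) ^ (2 * b) * T ^ (b + 1 / 2) := by
    intro w hw
    obtain ⟨h1, h2, h3, h4⟩ := hcirc w hw
    rw [riemannAuxConj, Complex.norm_conj]
    have e : 1 - conj w = ((1 - w.re : ℝ) : ℂ) + w.im * I := by
      apply Complex.ext <;> simp
    rw [e]
    have h := norm_riemannAux_le_rpow (σ := 1 - w.re) (A := 2 * b) (t := w.im)
      (abs_le.2 ⟨by linarith, by linarith⟩) (by nlinarith) (by linarith [hxA w.im h3])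
    refine h.trans (mul_le_mul_of_nonneg_left ?_ (by positivity))
    have := hsqrtT (1 + 2 * b) (by positivity) w.im h4
    refine this.trans (le_of_eq ?_)
    congr 1; ring
  -- `χ(z)`
  have hχ : ‖rsChi z‖ ≤ 30 * (2 * π) ^ (2 * b) * T := by
    have h := norm_rsChi_le_of_re_nonneg (x := z.re) (y := z.im) (by linarith) (by linarith)
    rw [Complex.re_add_im] at h
    refine h.trans ?_
    have h1 : (2 * π) ^ z.re ≤ (2 * π) ^ (2 * b) :=
      Real.rpow_le_rpow_of_exponent_le (by linarith) (by linarith)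
    have h2 : z.im + 1 / 2 ≤ 2 * T := by linarith
    have h3 : 0 ≤ z.im + 1 / 2 := by linarith
    calc 15 * (2 * π) ^ z.re * (z.im + 1 / 2) ≤ 15 * (2 * π) ^ (2 * b) * (2 * T) :=
          mul_le_mul (mul_le_mul_of_nonneg_left h1 (by norm_num)) h2 h3 (by positivity)
      _ = 30 * (2 * π) ^ (2 * b) * T := by ring
  -- Cauchy transfer
  have hP := norm_polyDerivOp_le φ (-L⁻¹) differentiable_riemannAux (s := z) one_pos hR
  have hD := norm_polyDerivOp_le ψ L⁻¹ differentiable_riemannAuxConj (s := z) one_pos hK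
  have hB₀ : ∑ k ∈ φ.support, |φ.coeff k| * |(-L⁻¹)| ^ k * (k.factorial : ℝ) / (1 : ℝ) ^ k ≤ A₀ := by
    have := sum_coeff_inv_le φ hL
    simpa only [abs_neg] using this
  have hB₂ := sum_coeff_inv_le ψ hL
  have hP' : ‖polyDerivOp φ (-L⁻¹) riemannAux z‖ ≤ A₀ * (6 * (4 : ℝ) ^ (2 * b + 1) * T ^ (b + 1)) :=
    hP.trans (mul_le_mul_of_nonneg_right hB₀ (by positivity))
  have hD' : ‖polyDerivOp ψ L⁻¹ riemannAuxConj z‖ ≤ A₂ * (6 * (4 : ℝ) ^ (2 * b) * T ^ (b + 1 / 2)) :=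
    hD.trans (mul_le_mul_of_nonneg_right hB₂ (by positivity))
  -- powers of `T`
  have hTb1 : T ^ (b + 1) ≤ T ^ (b + 2) := Real.rpow_le_rpow_of_exponent_le hT1' (by linarith)
  have hTb2 : T * T ^ (b + 1 / 2) ≤ T ^ (b + 2) := by
    have e : T * T ^ (b + 1 / 2) = T ^ (b + 3 / 2) := by
      rw [show b + 3 / 2 = 1 + (b + 1 / 2) by ring, Real.rpow_add hT0 1 (b + 1 / 2), Real.rpow_one]
    rw [e]
    exact Real.rpow_le_rpow_of_exponent_le hT1' (by linarith)
  -- assemble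
  rw [conreyV]
  refine (norm_add_le _ _).trans ?_
  rw [norm_mul]
  have h6 : 0 ≤ 6 * (4 : ℝ) ^ (2 * b + 1) := by positivity
  have h5 : 0 ≤ 6 * (4 : ℝ) ^ (2 * b) := by positivity
  have h30 : 0 ≤ 30 * (2 * π) ^ (2 * b) := by positivity
  calc ‖polyDerivOp φ (-L⁻¹) riemannAux z‖ + ‖rsChi z‖ * ‖polyDerivOp ψ L⁻¹ riemannAuxConj z‖
      ≤ A₀ * (6 * (4 : ℝ) ^ (2 * b + 1) * T ^ (b + 1)) +
          (30 * (2 * π) ^ (2 * b) * T) * (A₂ * (6 * (4 : ℝ) ^ (2 * b) * T ^ (b + 1 / 2))) :=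
        add_le_add hP' (mul_le_mul hχ hD' (norm_nonneg _) (by positivity))
    _ = A₀ * (6 * (4 : ℝ) ^ (2 * b + 1)) * T ^ (b + 1) +
          30 * (2 * π) ^ (2 * b) * A₂ * (6 * (4 : ℝ) ^ (2 * b)) * (T * T ^ (b + 1 / 2)) := by ring
    _ ≤ A₀ * (6 * (4 : ℝ) ^ (2 * b + 1)) * T ^ (b + 2) +
          30 * (2 * π) ^ (2 * b) * A₂ * (6 * (4 : ℝ) ^ (2 * b)) * T ^ (b + 2) := by
        gcongr
    _ = (A₀ * (6 * (4 : ℝ) ^ (2 * b + 1)) + 30 * (2 * π) ^ (2 * b) * A₂ * (6 * (4 : ℝ) ^ (2 * b))) *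
          T ^ (b + 2) := by ring

end Literature.NumberTheory.LFunctions

end
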